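import Mathlib
import Literature.Computability.AlgebraicComplexity.MatrixMultiplicationExponent

/-!
# `FidelityWitnesses.SevenEighthsLaw`, line `singlet-fraction-transfer`: `stub_sliceElimination`

Support file for crux item `stmt-MatrixMultiplication-4959`
(`Summit.MatrixMultiplication.MatrixMultiplication.Theses.FidelityWitnesses.SevenEighthsLaw`, `M(2,6) = 7`:
`|⟨S, ⟨2,2,2⟩⟩|² ≤ 7 · ‖S‖²` for every rank-`≤ 6` tensor `S` in the `2 × 2` format), line
`singlet-fraction-transfer`, registered stub `stub_sliceElimination` — EXACT OUTPUT ELIMINATION.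

Slots: `S a b c` with `a = (κ,ν)` the output slot, `b = (κ,μ)`, `c = (μ,ν)`, all in `Fin 2 × Fin 2`;
`matMulTensor ℂ 2 2 2 a b c = [a.1 = b.1 ∧ b.2 = c.1 ∧ a.2 = c.2]`.  For an orthonormal `k`-frame `e` of
`ℂ^{Fin 2 × Fin 2} ⊗ ℂ^{Fin 2 × Fin 2}` (inner product `⟨f, g⟩ = Σ conj f · g`) write
`τ_{s,a} := Σ_m e_s (a.1,m) (m,a.2)` (the "multiplied" vector of `e_s`) and
`cap e := Σ_s Σ_a |τ_{s,a}|²`.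

* `stub_sliceElimination` — if every output slice `S(a,·,·)` lies in `span e`, then
  `|Σ S · ⟨2,2,2⟩|² ≤ ‖S‖² · cap e`.

Proof (orthonormal expansion + Cauchy–Schwarz): `Submodule.mem_span_range_iff_exists_fun` gives
coefficients `d_{a,s}` with `S(a,·,·) = Σ_s d_{a,s} e_s`; orthonormality identifies
`d_{a,t} = ⟨e_t, S_a⟩` (`inner_frame_slice`) and yields Parseval `Σ_{b,c} |S(a,b,c)|² = Σ_s |d_{a,s}|²`
(`parseval_slice`); the slice `T_a` of `⟨2,2,2⟩` is the indicator of `(b,c) = ((a.1,m),(m,a.2))`, so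
`Σ_{b,c} S(a,b,c) T(a,b,c) = Σ_m S(a,(a.1,m),(m,a.2)) = Σ_s d_{a,s} τ_{s,a}` (`slice_sum_matMulTensor`);
finally Cauchy–Schwarz over the finite index set `(a,s)` (`norm_sum_sum_mul_sq_le`).
Mathlib only, plus the tree definition `matMulTensor`.
-/

set_option linter.dupNamespace false

namespace Summit.MatrixMultiplication.MatrixMultiplication.Theorems.SevenEighthsLaw

open scoped BigOperators ComplexConjugate
open Literature.Computability.AlgebraicComplexity

/-! ## Finite Cauchy–Schwarz for complex sums -/

/-- Cauchy–Schwarz for a finite complex sum: `|Σ f g|² ≤ (Σ |f|²) (Σ |g|²)`. -/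
theorem norm_sum_mul_sq_le {ι : Type*} (s : Finset ι) (f g : ι → ℂ) :
    ‖∑ i ∈ s, f i * g i‖ ^ 2 ≤ (∑ i ∈ s, ‖f i‖ ^ 2) * ∑ i ∈ s, ‖g i‖ ^ 2 := by
  have h1 : ‖∑ i ∈ s, f i * g i‖ ≤ ∑ i ∈ s, ‖f i‖ * ‖g i‖ := by
    calc ‖∑ i ∈ s, f i * g i‖ ≤ ∑ i ∈ s, ‖f i * g i‖ := norm_sum_le _ _
      _ = ∑ i ∈ s, ‖f i‖ * ‖g i‖ := by simp_rw [norm_mul]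
  calc ‖∑ i ∈ s, f i * g i‖ ^ 2 ≤ (∑ i ∈ s, ‖f i‖ * ‖g i‖) ^ 2 :=
        pow_le_pow_left₀ (norm_nonneg _) h1 2
    _ ≤ (∑ i ∈ s, ‖f i‖ ^ 2) * ∑ i ∈ s, ‖g i‖ ^ 2 := Finset.sum_mul_sq_le_sq_mul_sq s _ _

/-- Cauchy–Schwarz for a finite complex double sum: `|Σ_{a,s} f g|² ≤ (Σ_{a,s} |f|²) (Σ_{a,s} |g|²)`. -/
theorem norm_sum_sum_mul_sq_le {α β : Type*} [Fintype α] [Fintype β] (f g : α → β → ℂ) :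
    ‖∑ a, ∑ s, f a s * g a s‖ ^ 2 ≤ (∑ a, ∑ s, ‖f a s‖ ^ 2) * ∑ a, ∑ s, ‖g a s‖ ^ 2 := by
  have h := norm_sum_mul_sq_le Finset.univ (fun p : α × β => f p.1 p.2) (fun p => g p.1 p.2)
  simpa only [Fintype.sum_prod_type] using h

/-! ## The output slices of `⟨2,2,2⟩` -/

/-- The output slice `T_a` of `⟨2,2,2⟩` is the indicator of `(b,c) = ((a.1,m),(m,a.2))`, `m : Fin 2`:
pairing any `F` against it reads off `Σ_m F (a.1,m) (m,a.2)`. -/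
theorem slice_sum_matMulTensor (F : (Fin 2 × Fin 2) → (Fin 2 × Fin 2) → ℂ) (a : Fin 2 × Fin 2) :
    ∑ b, ∑ c, F b c * matMulTensor ℂ 2 2 2 a b c = ∑ m : Fin 2, F (a.1, m) (m, a.2) := by
  obtain ⟨a1, a2⟩ := a
  fin_cases a1 <;> fin_cases a2 <;>
    simp [Fintype.sum_prod_type, Fin.sum_univ_two, matMulTensor]

/-! ## Orthonormal expansion of the slices -/

/-- Moving a sum over the frame index out of a double slot sum. -/
theorem slot_sum_comm_frame {k : ℕ} (Z : (Fin 2 × Fin 2) → (Fin 2 × Fin 2) → Fin k → ℂ) :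
    ∑ b, ∑ c, ∑ s, Z b c s = ∑ s, ∑ b, ∑ c, Z b c s := by
  calc ∑ b, ∑ c, ∑ s, Z b c s = ∑ b, ∑ s, ∑ c, Z b c s :=
        Finset.sum_congr rfl fun b _ => Finset.sum_comm
    _ = ∑ s, ∑ b, ∑ c, Z b c s := Finset.sum_comm

/-- Coefficient identification: if `F = Σ_s d_s e_s` for an orthonormal frame `e`, then
`⟨e_t, F⟩ = d_t`. -/
theorem inner_frame_slice {k : ℕ} (e : Fin k → (Fin 2 × Fin 2) → (Fin 2 × Fin 2) → ℂ)
    (he : ∀ s t : Fin k, (∑ b, ∑ c, conj (e s b c) * e t b c) = if s = t then 1 else 0)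
    (d : Fin k → ℂ) (F : (Fin 2 × Fin 2) → (Fin 2 × Fin 2) → ℂ)
    (hF : ∀ b c, F b c = ∑ s, d s * e s b c) (t : Fin k) :
    ∑ b, ∑ c, conj (e t b c) * F b c = d t := by
  calc ∑ b, ∑ c, conj (e t b c) * F b c
      = ∑ b, ∑ c, ∑ s, d s * (conj (e t b c) * e s b c) := by
        refine Finset.sum_congr rfl fun b _ => Finset.sum_congr rfl fun c _ => ?_
        rw [hF b c, Finset.mul_sum]
        exact Finset.sum_congr rfl fun s _ => by ring
    _ = ∑ s, d s * ∑ b, ∑ c, conj (e t b c) * e s b c := by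
        rw [slot_sum_comm_frame]
        refine Finset.sum_congr rfl fun s _ => ?_
        rw [Finset.mul_sum]
        exact Finset.sum_congr rfl fun b _ => by rw [Finset.mul_sum]
    _ = ∑ s, d s * (if t = s then 1 else 0) := by
        refine Finset.sum_congr rfl fun s _ => ?_
        rw [he t s]
    _ = d t := by simp

/-- Parseval inside the span of an orthonormal frame: if `F = Σ_s d_s e_s` then
`Σ_{b,c} |F b c|² = Σ_s |d_s|²`. -/
theorem parseval_slice {k : ℕ} (e : Fin k → (Fin 2 × Fin 2) → (Fin 2 × Fin 2) → ℂ)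
    (he : ∀ s t : Fin k, (∑ b, ∑ c, conj (e s b c) * e t b c) = if s = t then 1 else 0)
    (d : Fin k → ℂ) (F : (Fin 2 × Fin 2) → (Fin 2 × Fin 2) → ℂ)
    (hF : ∀ b c, F b c = ∑ s, d s * e s b c) :
    ∑ b, ∑ c, ‖F b c‖ ^ 2 = ∑ s, ‖d s‖ ^ 2 := by
  have hFc : ∀ b c, conj (F b c) = ∑ s, conj (d s) * conj (e s b c) := by
    intro b c
    rw [hF b c, map_sum]
    exact Finset.sum_congr rfl fun s _ => by rw [map_mul]
  have hC : (∑ b, ∑ c, conj (F b c) * F b c) = ∑ s, conj (d s) * d s := by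
    calc ∑ b, ∑ c, conj (F b c) * F b c
        = ∑ b, ∑ c, ∑ s, conj (d s) * (conj (e s b c) * F b c) := by
          refine Finset.sum_congr rfl fun b _ => Finset.sum_congr rfl fun c _ => ?_
          rw [hFc b c, Finset.sum_mul]
          exact Finset.sum_congr rfl fun s _ => by ring
      _ = ∑ s, conj (d s) * ∑ b, ∑ c, conj (e s b c) * F b c := by
          rw [slot_sum_comm_frame]
          refine Finset.sum_congr rfl fun s _ => ?_
          rw [Finset.mul_sum]
          exact Finset.sum_congr rfl fun b _ => by rw [Finset.mul_sum]
      _ = ∑ s, conj (d s) * d s :=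
          Finset.sum_congr rfl fun s _ => by rw [inner_frame_slice e he d F hF s]
  simp_rw [Complex.conj_mul'] at hC
  exact_mod_cast hC

/-! ## The stub -/

/-- **Slice elimination (exact output elimination)** — stub `stub_sliceElimination` of line
`singlet-fraction-transfer` for `SevenEighthsLaw`.  For an orthonormal `k`-frame `e` of
`ℂ^{Fin 2 × Fin 2} ⊗ ℂ^{Fin 2 × Fin 2}` (for `⟨f,g⟩ = Σ conj f · g`) and a tensor `S` all of whose output
slices `S(a,·,·)` lie in `span e`:
`|Σ_{a,b,c} S(a,b,c) ⟨2,2,2⟩(a,b,c)|² ≤ (Σ |S|²) · Σ_s Σ_a |Σ_m e_s (a.1,m) (m,a.2)|²`.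
Proof: expand `S(a,·,·) = Σ_s d_{a,s} e_s`; the slice pairing is `Σ_s d_{a,s} τ_{s,a}`
(`slice_sum_matMulTensor`), `Σ_{b,c}|S(a,b,c)|² = Σ_s |d_{a,s}|²` (`parseval_slice`), and Cauchy–Schwarz
over `(a,s)` (`norm_sum_sum_mul_sq_le`). -/
theorem stub_sliceElimination {k : ℕ} (e : Fin k → (Fin 2 × Fin 2) → (Fin 2 × Fin 2) → ℂ)
    (he : ∀ s t : Fin k, (∑ b, ∑ c, conj (e s b c) * e t b c) = if s = t then 1 else 0)
    (S : (Fin 2 × Fin 2) → (Fin 2 × Fin 2) → (Fin 2 × Fin 2) → ℂ)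
    (hS : ∀ a : Fin 2 × Fin 2, S a ∈ Submodule.span ℂ (Set.range e)) :
    ‖∑ a, ∑ b, ∑ c, S a b c * matMulTensor ℂ 2 2 2 a b c‖ ^ 2
      ≤ (∑ a, ∑ b, ∑ c, ‖S a b c‖ ^ 2) *
        ∑ s, ∑ a : Fin 2 × Fin 2, ‖∑ m : Fin 2, e s (a.1, m) (m, a.2)‖ ^ 2 := by
  classical
  -- coefficients of the slices in the frame
  have hd : ∀ a : Fin 2 × Fin 2, ∃ d : Fin k → ℂ, ∑ s, d s • e s = S a := fun a =>
    (Submodule.mem_span_range_iff_exists_fun ℂ).mp (hS a)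
  choose d hd using hd
  have hexp : ∀ a b c, S a b c = ∑ s, d a s * e s b c := by
    intro a b c
    have h := congrFun (congrFun (hd a) b) c
    simpa [Finset.sum_apply, Pi.smul_apply, smul_eq_mul] using h.symm
  -- the pairing, slice by slice
  have hL : ∑ a, ∑ b, ∑ c, S a b c * matMulTensor ℂ 2 2 2 a b c
      = ∑ a, ∑ s, d a s * ∑ m : Fin 2, e s (a.1, m) (m, a.2) := by
    refine Finset.sum_congr rfl fun a _ => ?_
    rw [slice_sum_matMulTensor (S a) a]
    calc ∑ m : Fin 2, S a (a.1, m) (m, a.2) = ∑ m : Fin 2, ∑ s, d a s * e s (a.1, m) (m, a.2) :=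
          Finset.sum_congr rfl fun m _ => hexp a _ _
      _ = ∑ s, ∑ m : Fin 2, d a s * e s (a.1, m) (m, a.2) := Finset.sum_comm
      _ = ∑ s, d a s * ∑ m : Fin 2, e s (a.1, m) (m, a.2) :=
          Finset.sum_congr rfl fun s _ => by rw [Finset.mul_sum]
  -- Parseval, slice by slice
  have hR : ∑ a, ∑ b, ∑ c, ‖S a b c‖ ^ 2 = ∑ a, ∑ s, ‖d a s‖ ^ 2 :=
    Finset.sum_congr rfl fun a _ => parseval_slice e he (d a) (S a) (hexp a)
  rw [hL, hR, Finset.sum_comm (f := fun s (a : Fin 2 × Fin 2) => ‖∑ m : Fin 2, e s (a.1, m) (m, a.2)‖ ^ 2)]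
  exact norm_sum_sum_mul_sq_le d fun a s => ∑ m : Fin 2, e s (a.1, m) (m, a.2)

end Summit.MatrixMultiplication.MatrixMultiplication.Theorems.SevenEighthsLaw
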